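import Mathlib

/-!
# Large swirl: the slow family, the fast pair and the universal inner solution (K29)

Solo seat `solo-NavierStokesRegularity-informed`, session 13; companion of
`paper/axisymmetric-rigidity.md` §5f (the `σ⁻³` law of the polar mass defect, numerics + matched asymptotics). This file
certifies the exact identities on which the three-layer picture rests; the matching itself and the sign of the universal
constant `k₁` are NOT formalised.

* Outer layer. `largeSwirl_slow_hasDerivAt`: `v_sl(φ) = (3/2)(k sin²φ - sin φ cos φ)` solves `v' = 3/2 + 2 v cot φ`;
  `largeSwirl_slow_cone` (`v_sl(z₁) = 0` for `k = cot z₁`), `largeSwirl_slow_D` (with `u_sl := -1/2 - v cot φ` the divergence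
  equation `v' = -3u - v cot φ` holds exactly), `largeSwirl_slow_A` (`s ∝ sin φ` solves the swirl equation when `1 + 2u = -2v cot φ`),
  `largeSwirl_linear_cone` (`k = 0` gives the linear cone `1 + 2u = 3cos²φ`);
* Fast pair. `largeSwirl_fast_w`, `largeSwirl_fast_U`: the exact equations of `w = s² - 2p + 1/4` and `U = 1 + 2u + 2v cot φ`
  along (S) — the `O(s²)cot φ` terms cancel in `w'`, and `U' = 2w/v + 3cot φ - U cot φ - U²/(2v)`;
  `largeSwirl_exponents`: `(9/4)λ² + 4σ² = (9/4)(λ - (4σ/3)i)(λ + (4σ/3)i)` (the purely imaginary exponents `±4iσ/3`);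
* Inner layer. `largeSwirl_exact_R/_D/_A/_P`: `E_b = (1, -3ξ/2, bξ, b²ξ²/2 - 1)` solves the thin-cone system (S₀) exactly;
  `largeSwirl_scale_D/_P/_R` : the scaling symmetry `(ξ, V) ↦ (λξ, λV)` of (S₀).
No new definitions; axioms: standard.
-/

namespace Summit.NavierStokesRegularity.NavierStokesRegularity.Theorems

/-- The slow family `v_sl(φ) = (3/2)(k sin²φ - sin φ cos φ)` solves `v' = 3/2 + 2 v cot φ` (away from `sin φ = 0`). -/
theorem largeSwirl_slow_hasDerivAt (k : ℝ) {φ : ℝ} (hs : Real.sin φ ≠ 0) :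
    HasDerivAt (fun φ => 3 / 2 * (k * Real.sin φ ^ 2 - Real.sin φ * Real.cos φ))
      (3 / 2 + 2 * (3 / 2 * (k * Real.sin φ ^ 2 - Real.sin φ * Real.cos φ)) * (Real.cos φ / Real.sin φ)) φ := by
  have h1 : HasDerivAt (fun φ => Real.sin φ ^ 2) (2 * Real.sin φ * Real.cos φ) φ := by
    have := (Real.hasDerivAt_sin φ).mul (Real.hasDerivAt_sin φ)
    refine (this.congr_deriv (by ring)).congr_of_eventuallyEq ?_
    exact Filter.Eventually.of_forall fun x => by simp [pow_two]
  have h2 : HasDerivAt (fun φ => Real.sin φ * Real.cos φ) (Real.cos φ * Real.cos φ + Real.sin φ * -Real.sin φ) φ :=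
    (Real.hasDerivAt_sin φ).mul (Real.hasDerivAt_cos φ)
  have h : HasDerivAt (fun φ => 3 / 2 * (k * Real.sin φ ^ 2 - Real.sin φ * Real.cos φ))
      (3 / 2 * (k * (2 * Real.sin φ * Real.cos φ) - (Real.cos φ * Real.cos φ + Real.sin φ * -Real.sin φ))) φ :=
    ((h1.const_mul k).sub h2).const_mul (3 / 2)
  refine h.congr_deriv ?_
  have key := Real.sin_sq_add_cos_sq φ
  have e : 2 * (3 / 2 * (k * Real.sin φ ^ 2 - Real.sin φ * Real.cos φ)) * (Real.cos φ / Real.sin φ)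
      = 3 * k * Real.sin φ * Real.cos φ - 3 * Real.cos φ ^ 2 := by
    field_simp
  rw [e]
  linear_combination (3 / 2 : ℝ) * key

/-- The slow family vanishes at the cone: `v_sl(z₁) = 0` for `k = cot z₁ = cos z₁/sin z₁`. -/
theorem largeSwirl_slow_cone {z : ℝ} (_hs : Real.sin z ≠ 0) :
    3 / 2 * (Real.cos z / Real.sin z * Real.sin z ^ 2 - Real.sin z * Real.cos z) = 0 := by
  field_simp
  ring

/-- On the slow manifold `1 + 2u + 2v cot φ = 0`, i.e. `u = -1/2 - v cot φ`, the divergence equation `v' = -3u - v cot φ`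
is `v' = 3/2 + 2 v cot φ`. -/
theorem largeSwirl_slow_D (v c : ℝ) : -3 * (-1 / 2 - v * c) - v * c = 3 / 2 + 2 * v * c := by
  ring

/-- On the slow manifold the swirl equation `v s' = -s(1 + 2u + v cot φ)` is solved by `s = a sin φ` (`a = σ/sin z₁`). -/
theorem largeSwirl_slow_A {u v a φ : ℝ} (hs : Real.sin φ ≠ 0)
    (hU : 1 + 2 * u = -2 * v * (Real.cos φ / Real.sin φ)) :
    v * (a * Real.cos φ) = -(a * Real.sin φ) * (1 + 2 * u + v * (Real.cos φ / Real.sin φ)) := by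
  rw [hU]
  field_simp
  ring

/-- At `k = 0` (`z₁ = π/2`) the slow family is the linear cone: `v = -(3/2) sin φ cos φ` and `1 + 2u = 3cos²φ`. -/
theorem largeSwirl_linear_cone {φ : ℝ} (hs : Real.sin φ ≠ 0) :
    1 + 2 * (-1 / 2 - (3 / 2 * (0 * Real.sin φ ^ 2 - Real.sin φ * Real.cos φ)) * (Real.cos φ / Real.sin φ))
      = 3 * Real.cos φ ^ 2 := by
  field_simp
  ring

/-- The fast variable `w = s² - 2p + 1/4`: along (S) (`c = cot φ`), `w' = 2ss' - 2p' = -2s²U/v - 2(u-1)v - 2v²c` with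
`U = 1 + 2u + 2vc` — the `O(s²) c` terms cancel exactly. -/
theorem largeSwirl_fast_w {u v s c : ℝ} (hv : v ≠ 0) :
    2 * s * (-s * (1 + 2 * u + v * c) / v) - 2 * ((u - 1) * v + (v ^ 2 + s ^ 2) * c)
      = -2 * s ^ 2 * (1 + 2 * u + 2 * v * c) / v - 2 * (u - 1) * v - 2 * v ^ 2 * c := by
  field_simp
  ring

/-- The fast variable `U = 1 + 2u + 2v cot φ`: along (S), with `cot' = -(1 + cot²)`,
`U' = 2u' + 2v'c - 2v(1 + c²) = 2w/v + 3c - Uc - U²/(2v)`, `w = s² - 2p + 1/4`. -/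
theorem largeSwirl_fast_U {u v s p c : ℝ} (hv : v ≠ 0) :
    2 * ((v ^ 2 + s ^ 2 - 2 * p - u - u ^ 2) / v) + 2 * (-3 * u - v * c) * c - 2 * v * (1 + c ^ 2)
      = 2 * (s ^ 2 - 2 * p + 1 / 4) / v + 3 * c - (1 + 2 * u + 2 * v * c) * c
        - (1 + 2 * u + 2 * v * c) ^ 2 / (2 * v) := by
  field_simp
  ring

/-- The exponents of the linearised germ recursion at a swirling cone: `det [[3λ/2, -2σ], [2σ, 3λ/2]] = (9/4)λ² + 4σ²`
factors as `(9/4)(λ - (4σ/3)i)(λ + (4σ/3)i)` — the homogeneous exponents are `λ = ±4iσ/3`, purely imaginary. -/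
theorem largeSwirl_exponents (l s : ℂ) :
    9 / 4 * l ^ 2 + 4 * s ^ 2 = 9 / 4 * (l - 4 * s / 3 * Complex.I) * (l + 4 * s / 3 * Complex.I) := by
  linear_combination ((4 : ℂ) * s ^ 2) * Complex.I_sq

/-- Inner layer: `E_b = (u, V, s, p) = (1, -3ξ/2, bξ, b²ξ²/2 - 1)` solves the radial equation of the thin-cone system (S₀),
`V u' = s² - 2p - u - u²` (with `u' = 0`). -/
theorem largeSwirl_exact_R (b x : ℝ) :
    (-3 * x / 2) * 0 = (b * x) ^ 2 - 2 * (b ^ 2 * x ^ 2 / 2 - 1) - 1 - 1 ^ 2 := by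
  ring

/-- `E_b` solves the divergence equation of (S₀), `V' = -3u - V/ξ` (`V' = -3/2`). -/
theorem largeSwirl_exact_D {x : ℝ} (hx : x ≠ 0) : (-3 / 2 : ℝ) = -3 * 1 - (-3 * x / 2) / x := by
  field_simp
  ring

/-- `E_b` solves the swirl equation of (S₀), `V s' = -s(1 + 2u + V/ξ)` (`s' = b`). -/
theorem largeSwirl_exact_A {x : ℝ} (hx : x ≠ 0) (b : ℝ) :
    (-3 * x / 2) * b = -(b * x) * (1 + 2 * 1 + (-3 * x / 2) / x) := by
  field_simp
  ring

/-- `E_b` solves the cyclostrophic equation of (S₀), `p' = s²/ξ` (`p' = b²ξ`). -/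
theorem largeSwirl_exact_P {x : ℝ} (hx : x ≠ 0) (b : ℝ) : b ^ 2 * x = (b * x) ^ 2 / x := by
  field_simp

/-- Scaling symmetry of (S₀), divergence equation: if `V' = -3u - V/(λξ)` at the point `λξ`, then `Ṽ(ξ) := V(λξ)/λ`
(whose derivative is `V'(λξ)`, cf. `thinCone_chain_div`) satisfies `Ṽ' = -3u - Ṽ/ξ`. -/
theorem largeSwirl_scale_D {dV u V l x : ℝ}
    (h : dV = -3 * u - V / (l * x)) : dV = -3 * u - (V / l) / x := by
  rw [h, div_div]

/-- Scaling symmetry of (S₀), cyclostrophic equation: `p' = s²/(λξ)` at `λξ` gives `d/dξ p(λξ) = λ p' = s²/ξ`. -/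
theorem largeSwirl_scale_P {dp s l x : ℝ} (hl : l ≠ 0) (hx : x ≠ 0)
    (h : dp = s ^ 2 / (l * x)) : l * dp = s ^ 2 / x := by
  rw [h]
  field_simp

/-- Scaling symmetry of (S₀), radial and swirl equations: `(V/λ)(λ u') = V u'`, so these equations are unchanged. -/
theorem largeSwirl_scale_R {V l du : ℝ} (hl : l ≠ 0) : (V / l) * (l * du) = V * du := by
  field_simp

end Summit.NavierStokesRegularity.NavierStokesRegularity.Theorems
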